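import Summits.AtomisticToContinuum.FouriersLaw.Theorems.BondHeatUncertaintySubdiffusiveBondHeatBathBondReductionGenerator
import Literature.MathematicalPhysics.KineticTheory.LangevinChainConfined

/-!
# `NonBallistic` / column-flat Green–Kubo matrix, part 1: the generator identity at an interior site

Helper file for crux `stmt-AtomisticToContinuum-9127` (`JunctionLocality.NonBallistic`), line
`contact-current-forgetting`, stub `stub_columnFlatGreenKubo` (forward-only column flatness of the equilibrium
Green–Kubo matrix of the open pinned chain). The row constancy of the integrated Green–Kubo matrix rests on the
LOCAL ENERGY BALANCE AT AN INTERIOR SITE: for three consecutive sites `a, b, c` (`b = a + 1`, `c = b + 1`) of a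
chain with differentiable potentials and the symmetrically split site energy
`ẽ_b = p_b²/2 + U(q_b) + ½ V(q_c - q_b) + ½ V(q_b - q_a)`,

  `L_{T_L,T_R} ẽ_b = j_a - j_b`                                                              (G_int)

pointwise, where `L = OscillatorChain.generator` and `j_i = -½ (p_i + p_{i+1}) V'(q_{i+1} - q_i)` is BLR's bond
current `OscillatorChain.bondCurrent` (no bath term: an interior site carries no thermostat). This is the
interior instance of the route item `HonestZwanzig.GeneratorSiteEnergy`, proved here as a calculus identity:

* `partialP_splitSiteEnergy`, `partialP_partialP_splitSiteEnergy`, `partialQ_splitSiteEnergy` — coordinate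
  derivatives of `ẽ_b`;
* `dPotential_interior` — `∂_{q_b} H = U'(q_b) + V'(q_b - q_a) - V'(q_c - q_b)`;
* `generator_splitSiteEnergy` — (G_int); `pinnedChain_generator_splitSiteEnergy` — (G_int) for the pinned
  anharmonic chain;
* `contDiff_splitSiteEnergy`, `splitSiteEnergy_neg_momentum`, `pinnedChain_splitSiteEnergy_nonneg_le` —
  regularity, momentum parity and the size bound `0 ≤ ẽ_b ≤ 2H`.

Nothing here closes an item.
-/

noncomputable section

open MeasureTheory Filter Topology Set Finset
open Literature.MathematicalPhysics.KineticTheory.HeatConduction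

namespace Summit.AtomisticToContinuum.FouriersLaw.Theorems.NonBallistic

open Summit.AtomisticToContinuum.FouriersLaw.Theorems.SubdiffusiveBondHeat

variable {N : ℕ}

/-! ### Coordinate derivatives of the split site energy -/

section SplitSiteEnergy

variable (P : OscillatorChain) {a b c : Fin N}

/-- `∂_{p_i} ẽ_b = [i = b] p_b` for `ẽ_b = p_b²/2 + U(q_b) + ½V(q_c - q_b) + ½V(q_b - q_a)` (no hypothesis on
`U, V`). [folklore] -/
theorem partialP_splitSiteEnergy (i : Fin N) (y : PhaseSpace N) :
    partialP i (fun z : PhaseSpace N => (z.2 b) ^ 2 / 2 + P.U (z.1 b) + P.V (z.1 c - z.1 b) / 2 +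
      P.V (z.1 b - z.1 a) / 2) y = if i = b then y.2 b else 0 := by
  unfold partialP
  by_cases hi : i = b
  · subst hi
    simp only [Function.update_self, if_true]
    have h : HasDerivAt (fun t : ℝ => t ^ 2 / 2 + P.U (y.1 i) + P.V (y.1 c - y.1 i) / 2 +
        P.V (y.1 i - y.1 a) / 2) (y.2 i) (y.2 i) := by
      have h1 := ((hasDerivAt_pow 2 (y.2 i)).div_const 2).add_const
        (P.U (y.1 i) + P.V (y.1 c - y.1 i) / 2 + P.V (y.1 i - y.1 a) / 2)
      refine (h1.congr_deriv ?_).congr_of_eventuallyEq ?_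
      · push_cast; ring
      · exact Eventually.of_forall fun t => by ring
    exact h.deriv
  · have hne : b ≠ i := Ne.symm hi
    simp only [hi, if_false, Function.update_of_ne hne, deriv_const']

/-- `∂_{p_i} ẽ_b` as a function. [folklore] -/
theorem partialP_splitSiteEnergy_eq (i : Fin N) :
    partialP i (fun z : PhaseSpace N => (z.2 b) ^ 2 / 2 + P.U (z.1 b) + P.V (z.1 c - z.1 b) / 2 +
      P.V (z.1 b - z.1 a) / 2) = fun y => if i = b then y.2 b else 0 :=
  funext fun y => partialP_splitSiteEnergy P i y

/-- `∂²_{p_i} ẽ_b = [i = b]`. [folklore] -/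
theorem partialP_partialP_splitSiteEnergy (i : Fin N) (y : PhaseSpace N) :
    partialP i (partialP i (fun z : PhaseSpace N => (z.2 b) ^ 2 / 2 + P.U (z.1 b) + P.V (z.1 c - z.1 b) / 2 +
      P.V (z.1 b - z.1 a) / 2)) y = if i = b then 1 else 0 := by
  rw [partialP_splitSiteEnergy_eq P i]
  unfold partialP
  by_cases hi : i = b
  · subst hi
    simp only [if_true, Function.update_self]
    exact (hasDerivAt_id' (y.2 i)).deriv
  · simp only [hi, if_false, deriv_const']

/-- `∂_{q_i} ẽ_b = [i = b] U'(q_b) + ½V'(q_c - q_b)([i = c] - [i = b]) + ½V'(q_b - q_a)([i = b] - [i = a])` for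
differentiable `U, V` (chain rule along the coordinate line `q_i`). [folklore] -/
theorem partialQ_splitSiteEnergy (hU : Differentiable ℝ P.U) (hV : Differentiable ℝ P.V) (i : Fin N)
    (y : PhaseSpace N) :
    partialQ i (fun z : PhaseSpace N => (z.2 b) ^ 2 / 2 + P.U (z.1 b) + P.V (z.1 c - z.1 b) / 2 +
      P.V (z.1 b - z.1 a) / 2) y =
      (if i = b then deriv P.U (y.1 b) else 0) +
        deriv P.V (y.1 c - y.1 b) / 2 * ((if i = c then 1 else 0) - (if i = b then 1 else 0)) +
        deriv P.V (y.1 b - y.1 a) / 2 * ((if i = b then 1 else 0) - (if i = a then 1 else 0)) := by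
  unfold partialQ
  have hq : ∀ k : Fin N, HasDerivAt (fun t : ℝ => Function.update y.1 i t k) (if i = k then 1 else 0) (y.1 i) := by
    intro k
    by_cases hk : i = k
    · subst hk; simp only [Function.update_self, if_true]; exact hasDerivAt_id _
    · simp only [Function.update_of_ne (Ne.symm hk), hk, if_false]; exact hasDerivAt_const _ _
  have hpt : ∀ k : Fin N, Function.update y.1 i (y.1 i) k = y.1 k := fun k => by
    rw [Function.update_eq_self]
  have hUb : HasDerivAt (fun t => P.U (Function.update y.1 i t b))
      (deriv P.U (y.1 b) * (if i = b then 1 else 0)) (y.1 i) := by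
    have h := (hU (Function.update y.1 i (y.1 i) b)).hasDerivAt.comp (y.1 i) (hq b)
    rw [hpt] at h
    exact h
  have hVcb : HasDerivAt (fun t => P.V (Function.update y.1 i t c - Function.update y.1 i t b))
      (deriv P.V (y.1 c - y.1 b) * ((if i = c then 1 else 0) - (if i = b then 1 else 0))) (y.1 i) := by
    have h := (hV (Function.update y.1 i (y.1 i) c - Function.update y.1 i (y.1 i) b)).hasDerivAt.comp
      (y.1 i) ((hq c).sub (hq b))
    rw [hpt, hpt] at h
    exact h
  have hVba : HasDerivAt (fun t => P.V (Function.update y.1 i t b - Function.update y.1 i t a))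
      (deriv P.V (y.1 b - y.1 a) * ((if i = b then 1 else 0) - (if i = a then 1 else 0))) (y.1 i) := by
    have h := (hV (Function.update y.1 i (y.1 i) b - Function.update y.1 i (y.1 i) a)).hasDerivAt.comp
      (y.1 i) ((hq b).sub (hq a))
    rw [hpt, hpt] at h
    exact h
  have hconst : HasDerivAt (fun _ : ℝ => (y.2 b) ^ 2 / 2) 0 (y.1 i) := hasDerivAt_const _ _
  have h := ((hconst.add hUb).add (hVcb.div_const 2)).add (hVba.div_const 2)
  refine h.deriv.trans ?_
  split_ifs <;> ring

/-- `∂_{q_b} H = ∂Φ/∂q_b = U'(q_b) + V'(q_b - q_a) - V'(q_c - q_b)` at an interior site `b` (`a = b - 1`,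
`c = b + 1` both sites; closed form of `OscillatorChain.dPotential`). [folklore] -/
theorem dPotential_interior (hab : b.val = a.val + 1) (hbc : c.val = b.val + 1) (q : Fin N → ℝ) :
    P.dPotential N b q = deriv P.U (q b) + deriv P.V (q b - q a) - deriv P.V (q c - q b) := by
  unfold OscillatorChain.dPotential
  have h1 : ∑ k : Fin N, ∑ l : Fin N, (if l.val = k.val + 1 then
        deriv P.V (q l - q k) * ((if l = b then 1 else 0) - (if k = b then 1 else 0)) else 0) =
      (∑ k : Fin N, ∑ l : Fin N, (if l.val = k.val + 1 then deriv P.V (q l - q k) * (if l = b then 1 else 0)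
        else 0)) -
      ∑ k : Fin N, ∑ l : Fin N, (if l.val = k.val + 1 then deriv P.V (q l - q k) * (if k = b then 1 else 0)
        else 0) := by
    rw [← Finset.sum_sub_distrib]
    refine Finset.sum_congr rfl fun k _ => ?_
    rw [← Finset.sum_sub_distrib]
    refine Finset.sum_congr rfl fun l _ => ?_
    split_ifs <;> ring
  have h2 : ∑ k : Fin N, ∑ l : Fin N, (if l.val = k.val + 1 then deriv P.V (q l - q k) * (if l = b then 1 else 0)
      else 0) = deriv P.V (q b - q a) := by
    rw [Finset.sum_eq_single a]
    · rw [Finset.sum_eq_single b]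
      · simp [hab]
      · intro l _ hl
        simp [hl]
      · simp
    · intro k _ hk
      refine Finset.sum_eq_zero fun l _ => ?_
      by_cases hl : l = b
      · subst hl
        have : ¬ (l.val = k.val + 1) := fun h => hk (Fin.ext (by omega))
        simp [this]
      · simp [hl]
    · simp
  have h3 : ∑ k : Fin N, ∑ l : Fin N, (if l.val = k.val + 1 then deriv P.V (q l - q k) * (if k = b then 1 else 0)
      else 0) = deriv P.V (q c - q b) := by
    rw [Finset.sum_eq_single b]
    · rw [Finset.sum_eq_single c]
      · simp [hbc]
      · intro l _ hl
        have : ¬ (l.val = b.val + 1) := fun h => hl (Fin.ext (by omega))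
        simp [this]
      · simp
    · intro k _ hk
      refine Finset.sum_eq_zero fun l _ => ?_
      simp [hk]
    · simp
  rw [h1, h2, h3]
  ring

/-! ### The generator identity `L ẽ_b = j_a - j_b` at an interior site -/

/-- **The generator identity at an interior site** (differentiable potentials; `a, b, c` three consecutive
sites, so that `b` carries no bath): `L_{T_L,T_R} ẽ_b = j_a - j_b` for
`ẽ_b = p_b²/2 + U(q_b) + ½V(q_c - q_b) + ½V(q_b - q_a)`, `j_i = -½(p_i + p_{i+1})V'(q_{i+1} - q_i)`. The
Hamiltonian part of `L` gives `p_b U' + ½V'(q_c-q_b)(p_c - p_b) + ½V'(q_b-q_a)(p_b - p_a) - (U' + V'(q_b-q_a) -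
V'(q_c-q_b)) p_b = ½(p_b+p_c)V'(q_c-q_b) - ½(p_a+p_b)V'(q_b-q_a)`; the baths act on `p_0, p_{N-1} ≠ p_b`, on which
`ẽ_b` does not depend. [Bonetto–Lebowitz–Rey-Bellet 2000, §5.2 eq. (23)–(25) (local energy balance)]
[folklore] -/
theorem generator_splitSiteEnergy (hU : Differentiable ℝ P.U) (hV : Differentiable ℝ P.V)
    (hab : b.val = a.val + 1) (hbc : c.val = b.val + 1) (T_L T_R : ℝ) (x : PhaseSpace N) :
    P.generator N T_L T_R (fun z : PhaseSpace N => (z.2 b) ^ 2 / 2 + P.U (z.1 b) + P.V (z.1 c - z.1 b) / 2 +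
      P.V (z.1 b - z.1 a) / 2) x = P.bondCurrent N a x - P.bondCurrent N b x := by
  have hb0 : b.val ≠ 0 := by omega
  have hbN : b.val ≠ N - 1 := by have := c.isLt; omega
  -- the three sums
  have hS1 : ∑ i : Fin N, x.2 i * partialQ i (fun z : PhaseSpace N => (z.2 b) ^ 2 / 2 + P.U (z.1 b) +
      P.V (z.1 c - z.1 b) / 2 + P.V (z.1 b - z.1 a) / 2) x =
      x.2 b * deriv P.U (x.1 b) + deriv P.V (x.1 c - x.1 b) / 2 * (x.2 c - x.2 b) +
        deriv P.V (x.1 b - x.1 a) / 2 * (x.2 b - x.2 a) := by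
    simp only [partialQ_splitSiteEnergy P hU hV, mul_add, mul_sub, Finset.sum_add_distrib,
      Finset.sum_sub_distrib, mul_ite, mul_one, mul_zero, Finset.sum_ite_eq', Finset.mem_univ, if_true]
    ring
  have hS2 : ∑ i : Fin N, partialQ i (P.hamiltonian N) x * partialP i (fun z : PhaseSpace N => (z.2 b) ^ 2 / 2 +
      P.U (z.1 b) + P.V (z.1 c - z.1 b) / 2 + P.V (z.1 b - z.1 a) / 2) x =
      (deriv P.U (x.1 b) + deriv P.V (x.1 b - x.1 a) - deriv P.V (x.1 c - x.1 b)) * x.2 b := by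
    simp only [partialP_splitSiteEnergy P, P.partialQ_hamiltonian_eq_dPotential hU hV, mul_ite, mul_zero,
      Finset.sum_ite_eq', Finset.mem_univ, if_true, dPotential_interior P hab hbc]
  have hS3 : ∑ i : Fin N, ((if i.val = 0 then T_L * partialP i (partialP i (fun z : PhaseSpace N =>
      (z.2 b) ^ 2 / 2 + P.U (z.1 b) + P.V (z.1 c - z.1 b) / 2 + P.V (z.1 b - z.1 a) / 2)) x -
        x.2 i * partialP i (fun z : PhaseSpace N => (z.2 b) ^ 2 / 2 + P.U (z.1 b) + P.V (z.1 c - z.1 b) / 2 +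
          P.V (z.1 b - z.1 a) / 2) x else 0) +
      (if i.val = N - 1 then T_R * partialP i (partialP i (fun z : PhaseSpace N =>
        (z.2 b) ^ 2 / 2 + P.U (z.1 b) + P.V (z.1 c - z.1 b) / 2 + P.V (z.1 b - z.1 a) / 2)) x -
        x.2 i * partialP i (fun z : PhaseSpace N => (z.2 b) ^ 2 / 2 + P.U (z.1 b) + P.V (z.1 c - z.1 b) / 2 +
          P.V (z.1 b - z.1 a) / 2) x else 0)) = 0 := by
    refine Finset.sum_eq_zero fun i _ => ?_
    simp only [partialP_splitSiteEnergy P, partialP_partialP_splitSiteEnergy P]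
    by_cases hi : i = b
    · subst hi
      simp [hb0, hbN]
    · simp [hi]
  unfold OscillatorChain.generator
  rw [Finset.sum_sub_distrib, hS1, hS2, hS3, bondCurrent_siteZero P (i0 := a) (i1 := b) hab x,
    bondCurrent_siteZero P (i0 := b) (i1 := c) hbc x]
  ring

/-- The split site energy is as smooth as the potentials. [folklore] -/
theorem contDiff_splitSiteEnergy {n : WithTop ℕ∞} (hU : ContDiff ℝ n P.U) (hV : ContDiff ℝ n P.V) :
    ContDiff ℝ n fun z : PhaseSpace N => (z.2 b) ^ 2 / 2 + P.U (z.1 b) + P.V (z.1 c - z.1 b) / 2 +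
      P.V (z.1 b - z.1 a) / 2 := by
  have h1 : ContDiff ℝ n fun z : PhaseSpace N => z.2 b := (contDiff_apply ℝ ℝ b).comp contDiff_snd
  have h2 : ContDiff ℝ n fun z : PhaseSpace N => z.1 b := (contDiff_apply ℝ ℝ b).comp contDiff_fst
  have h3 : ContDiff ℝ n fun z : PhaseSpace N => z.1 c := (contDiff_apply ℝ ℝ c).comp contDiff_fst
  have h4 : ContDiff ℝ n fun z : PhaseSpace N => z.1 a := (contDiff_apply ℝ ℝ a).comp contDiff_fst
  exact ((((h1.pow 2).div_const 2).add (hU.comp h2)).add ((hV.comp (h3.sub h2)).div_const 2)).add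
    ((hV.comp (h2.sub h4)).div_const 2)

/-- The split site energy is EVEN under momentum reversal. [folklore] -/
theorem splitSiteEnergy_neg_momentum (x : PhaseSpace N) :
    (fun z : PhaseSpace N => (z.2 b) ^ 2 / 2 + P.U (z.1 b) + P.V (z.1 c - z.1 b) / 2 + P.V (z.1 b - z.1 a) / 2)
        (x.1, -x.2) =
      (fun z : PhaseSpace N => (z.2 b) ^ 2 / 2 + P.U (z.1 b) + P.V (z.1 c - z.1 b) / 2 + P.V (z.1 b - z.1 a) / 2)
        x := by
  simp

end SplitSiteEnergy

/-! ### The pinned anharmonic chain -/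

section Pinned

variable {ω₂ lam β : ℝ}

/-- **(G_int) for the pinned anharmonic chain** `pinnedChain ω₂ lam β γ` (all real parameters): for three
consecutive sites `a, b, c`, `L_{T_L,T_R} ẽ_b = j_a - j_b` pointwise. [folklore] -/
theorem pinnedChain_generator_splitSiteEnergy :
    ∀ (ω₂ lam β γ T_L T_R : ℝ) (N : ℕ) (a b c : Fin N), b.val = a.val + 1 → c.val = b.val + 1 →
      ∀ x : PhaseSpace N,
      (pinnedChain ω₂ lam β γ).generator N T_L T_R (fun z : PhaseSpace N =>
          (z.2 b) ^ 2 / 2 + (pinnedChain ω₂ lam β γ).U (z.1 b) + (pinnedChain ω₂ lam β γ).V (z.1 c - z.1 b) / 2 +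
            (pinnedChain ω₂ lam β γ).V (z.1 b - z.1 a) / 2) x =
        (pinnedChain ω₂ lam β γ).bondCurrent N a x - (pinnedChain ω₂ lam β γ).bondCurrent N b x := by
  intro ω₂ lam β γ T_L T_R N a b c hab hbc x
  have hU : Differentiable ℝ (pinnedChain ω₂ lam β γ).U :=
    (pinnedChain_contDiff_U ω₂ lam β γ (n := 1)).differentiable one_ne_zero
  have hV : Differentiable ℝ (pinnedChain ω₂ lam β γ).V :=
    (pinnedChain_contDiff_V ω₂ lam β γ (n := 1)).differentiable one_ne_zero
  exact generator_splitSiteEnergy (pinnedChain ω₂ lam β γ) hU hV hab hbc T_L T_R x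

/-- `0 ≤ ẽ_b ≤ 2H` for the pinned chain (`ω₂, lam, β ≥ 0`; `a, b, c` consecutive): `p_b²/2 + U(q_b) ≤ H` and each
bond energy is at most `H`. [folklore] -/
theorem pinnedChain_splitSiteEnergy_nonneg_le (hω : 0 ≤ ω₂) (hl : 0 ≤ lam) (hβ : 0 ≤ β) (γ : ℝ) {a b c : Fin N}
    (hab : b.val = a.val + 1) (hbc : c.val = b.val + 1) (y : PhaseSpace N) :
    0 ≤ (y.2 b) ^ 2 / 2 + (pinnedChain ω₂ lam β γ).U (y.1 b) + (pinnedChain ω₂ lam β γ).V (y.1 c - y.1 b) / 2 +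
          (pinnedChain ω₂ lam β γ).V (y.1 b - y.1 a) / 2 ∧
      (y.2 b) ^ 2 / 2 + (pinnedChain ω₂ lam β γ).U (y.1 b) + (pinnedChain ω₂ lam β γ).V (y.1 c - y.1 b) / 2 +
          (pinnedChain ω₂ lam β γ).V (y.1 b - y.1 a) / 2 ≤
        2 * (pinnedChain ω₂ lam β γ).hamiltonian N y := by
  have hU0 : ∀ q, 0 ≤ (pinnedChain ω₂ lam β γ).U q := fun q => by
    show 0 ≤ ω₂ * q ^ 2 / 2 + lam * q ^ 4 / 4; positivity
  have hV0 : ∀ r, 0 ≤ (pinnedChain ω₂ lam β γ).V r := fun r => by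
    show 0 ≤ r ^ 2 / 2 + β * r ^ 4 / 4; positivity
  have hsite := (pinnedChain ω₂ lam β γ).site_le_hamiltonian hU0 hV0 N y b
  have hbond1 := (pinnedChain ω₂ lam β γ).bond_le_hamiltonian hU0 hV0 N y (k := b) (l := c) hbc
  have hbond2 := (pinnedChain ω₂ lam β γ).bond_le_hamiltonian hU0 hV0 N y (k := a) (l := b) hab
  have hU1 := hU0 (y.1 b)
  have hV1 := hV0 (y.1 c - y.1 b)
  have hV2 := hV0 (y.1 b - y.1 a)
  constructor
  · positivity
  · linarith

/-- The split site energy of the pinned chain is continuous. [folklore] -/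
theorem pinnedChain_continuous_splitSiteEnergy (ω₂ lam β γ : ℝ) (a b c : Fin N) :
    Continuous fun z : PhaseSpace N => (z.2 b) ^ 2 / 2 + (pinnedChain ω₂ lam β γ).U (z.1 b) +
      (pinnedChain ω₂ lam β γ).V (z.1 c - z.1 b) / 2 + (pinnedChain ω₂ lam β γ).V (z.1 b - z.1 a) / 2 :=
  (contDiff_splitSiteEnergy (pinnedChain ω₂ lam β γ) (pinnedChain_contDiff_U ω₂ lam β γ (n := 0))
    (pinnedChain_contDiff_V ω₂ lam β γ (n := 0))).continuous

end Pinned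

end Summit.AtomisticToContinuum.FouriersLaw.Theorems.NonBallistic

end
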